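import Summits.QuantumFields.YangMills.Theorems.SwapVirialDeficitSectorLaplaceBTubeCapStiffAssembly
import Summits.QuantumFields.YangMills.Theorems.SwapVirialDeficitSectorLaplaceBTubeCapFarFloorLambdaB
import HarnessLib

/-!
# STUB (S-B) OF SKELETON ➎: ★★★ `stub_B_stiff` CLOSED — the capped B-tubes carry plain stiffness above a polynomial threshold
# (free-hands support of ⟨stmt-QuantumFields-24197⟩ `SwapVirialDeficit.SwapGluedStiffness` ∕ ⟨24194⟩; cell ym-idea-1, LEAD g99 ruling 2026-08-31 21:48Z, assembler fcl-p3 g48)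

The far-floor package of ✓`stub_B_stiff_of_farFloor_pkg` (✓`…SectorLaplaceBTubeCapStiffAssembly`, g48) is DISCHARGED from w3 g67's ✓`bTubeCap_hfar`
(✓`…SectorLaplaceBTubeCapFarFloorLambdaB`, p835339: the `hfar` hypothesis of w2 g59's ✓`bTubeCap_stiff_of_farFloor` for every sign pattern, `0 < τ ≤ ½`, `0 ≤ X₁ ≤ 1`,
`0 ≤ R ≤ 1∕8`) with the constant radius `Rfl L τ := 1∕8` (`K_R = 8`, `k_R = 0`):

* `stub_B_farFloor` — the package `∃ Rfl KR kR, …` (the shape registered in skeleton ➎ v9∕v10);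
* ★★★ `bTubeCap_stiffness` — THE STUB `stub_B_stiff` OF SKELETON ➎ (HOME `fcl-p3-g48-SectorStiffnessSkeleton.lean`, statement of v8 VERBATIM) with NO hypothesis:
  `∃ K > 0, k, τ₀ ∈ (0, ½]: ∀ L, ∀ 0 < τ ≤ τ₀∕L^k, ∀ b ≥ K·L^k·τ⁻¹^k`,
  `stiffKappa L (1∕8) · Σ_good ∫_{BTubeCap L τ 1} e^{−bF̂} d(chartMeasure) ≤ b · Σ_good ∫_{BTubeCap L τ 1} F̂e^{−bF̂} d(chartMeasure)`.
  Credits: floors w3 g66∕g67 (✓StratumB*, ✓RelationQuaternions, ✓LetterFloors, ✓BTubeCapFarFloor(ΛB)), the √b law and its reading w2 g59 (✓BTubeFibred* … ✓BTubeCapRegion,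
  ✓BTubeCapHubCot), the cap LEAD g99 (memo9), thresholds∕sum g48.

HONEST LABEL: closes ONE region stub of ➎ ((S-B)); (S-core-tip) [w2 g60], (S-core-end) [LEAD g99 + w3 g67], (S-001-good) remain OPEN, so ⟨24197⟩ ∕ ⟨24194⟩ are OPEN; item of record
⟨24085⟩ SubOctaveBounded aside ∕ untouched; the Yang–Mills mass gap is NOT proved; no summit is proved by a line.  THEOREMS ONLY (0 `def`, 0 `sorry`), standard axioms; the
`attribute [local instance]` block is the series' measurable structure on `ℍ` (as in ✓`SectorLaplaceDefs`; nothing overridden).  Seat ym-line-fcl-p3 g48 (cell ym-idea-1, free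
hands), `--supports stmt-QuantumFields-24197`.  References: [cite: Luscher1983, §2]; [folklore].
-/

set_option autoImplicit false
set_option synthInstance.maxSize 1024

noncomputable section

open MeasureTheory Quaternion Set
open scoped Quaternion BigOperators ENNReal
open Literature.MathematicalPhysics.QuantumLattice
open Literature.MathematicalPhysics.QuantumFieldTheory hiding SU2
open Summit.QuantumFields.YangMills.Theorems.SwapTwistDeficit.ToronLog

attribute [local instance] Literature.Analysis.FluidPDE.Tao2016.quatMeasurableSpace
  Literature.Analysis.FluidPDE.Tao2016.quatBorelSpace
  Literature.MathematicalPhysics.QuantumLattice.secondCountableTopology_su2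

namespace Summit.QuantumFields.YangMills.Theorems.SwapVirialDeficit.SectorLaplace

open Summit.QuantumFields.YangMills.Theorems.FemtoTransferGap
open Summit.QuantumFields.YangMills.Theorems.FemtoTransferGap.TT
open Summit.QuantumFields.YangMills.Theorems.VirialFluxGap.RingDeficit
open Summit.QuantumFields.YangMills.Theorems.SwapVirialDeficit.SwapRing
open Summit.QuantumFields.YangMills.Theorems.SwapVirialDeficit.BlowUpRing

/-- THE FAR-FLOOR PACKAGE OF THE CAPPED B-TUBES (the shape `stub_B_farFloor` registered in skeleton ➎ v9∕v10), discharged with the constant radius `Rfl L τ := 1∕8`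
(`K_R = 8`, `k_R = 0`) from w3 g67's ✓`bTubeCap_hfar` at `X₁ = 1` (no sign hypothesis needed). [cite: Luscher1983, §2] -/
theorem stub_B_farFloor : ∃ Rfl : ℕ → ℝ → ℝ, ∃ KR : ℝ, ∃ kR : ℕ, 0 ≤ KR ∧
    (∀ (L : ℕ) [NeZero L] (τ : ℝ), 0 < τ → τ ≤ 1 / 2 → 0 < Rfl L τ ∧ (Rfl L τ)⁻¹ ≤ KR * (L : ℝ) ^ kR * τ⁻¹ ^ kR) ∧
    (∀ (L : ℕ) [NeZero L] (ε : GnoSign L), ε.2.1 = true → (ε.2.2 = fun _ => true) → ∀ τ : ℝ, 0 < τ → τ ≤ 1 / 2 →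
      ∀ R : ℝ, 0 < R → R ≤ Rfl L τ →
        ∀ u : ℝ × ℝ, τ ^ 2 ≤ u.1 ^ 2 + u.2 ^ 2 → ∀ y : GnoFibreB L, R ≤ ‖y‖ → gnoFibreBEquiv (u, gnoScaleB u y) ∈
          ({p : ℝ × GnoCoord L | 4 * p.1 ^ 2 / (1 + p.1 ^ 2) ^ 2 < τ ∧ τ ≤ (1 + p.1 ^ 2)⁻¹ ∧ |p.1| < τ * Real.sqrt (1 + p.1 ^ 2)} ∩
                {p : ℝ × GnoCoord L | τ ≤ Real.sqrt (p.2.1.1 1 ^ 2 + p.2.1.1 2 ^ 2)} ∩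
                {p : ℝ × GnoCoord L | |p.2.1.1 0| ≤ 1 * Real.sqrt (1 + p.2.1.1 1 ^ 2 + p.2.1.1 2 ^ 2)}) →
          τ ^ 2 / ((1 + τ ^ 2) * (12375 * (L : ℝ) ^ 10)) * R ^ 2 ≤
            gnoDeficit (fun _ => false) (fun _ => 1) (hubAt (gnoFibreBEquiv (u, gnoScaleB u y)).1 1) ε (gnoFibreBEquiv (u, gnoScaleB u y)).2) := by
  refine ⟨fun _ _ => 1 / 8, 8, 0, by norm_num, fun L _ τ _ _ => ⟨by norm_num, by norm_num⟩, fun L _ ε _ _ τ hτ hτ2 R hR hR8 => ?_⟩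
  exact bTubeCap_hfar ε hτ hτ2 (le_refl (0 : ℝ) |>.trans zero_le_one) le_rfl hR.le hR8

/-- ★★★ **`stub_B_stiff` OF SKELETON ➎ — CLOSED** (statement of HOME `fcl-p3-g47∕g48-SectorStiffnessSkeleton.lean` v8∕v9∕v10 VERBATIM, no hypothesis): above a polynomial threshold
`b ≥ K·L^k·τ⁻¹^k` (`0 < τ ≤ τ₀∕L^k`, `τ₀ = ½`) the capped B-tubes `BTubeCap L τ 1` of the good sign patterns carry plain stiffness `κ_L = 9L⁴ − 3∕2 + 1∕8` on `chartMeasure L`: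
`stiffKappa L (1∕8) · Σ_good ∫_{BTubeCap L τ 1} e^{−bF̂} ≤ b · Σ_good ∫_{BTubeCap L τ 1} F̂e^{−bF̂}` (✓`stub_B_stiff_of_farFloor_pkg` ∘ `stub_B_farFloor`). [cite: Luscher1983, §2] -/
theorem bTubeCap_stiffness : ∃ K : ℝ, 0 < K ∧ ∃ k : ℕ, ∃ τ₀ : ℝ, 0 < τ₀ ∧ τ₀ ≤ 1 / 2 ∧ ∀ (L : ℕ) [NeZero L] (τ : ℝ), 0 < τ → τ ≤ τ₀ / (L : ℝ) ^ k →
    ∀ b : ℝ, K * (L : ℝ) ^ k * τ⁻¹ ^ k ≤ b →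
      stiffKappa L (1 / 8) * ∑ ε ∈ (Finset.univ.filter fun ε : GnoSign L => GoodSign ε),
          ∫ x in BTubeCap L τ 1, Real.exp (-(b * gnoDeficit z₀ (fun _ => 1) x.1 ε x.2)) ∂chartMeasure L ≤
        b * ∑ ε ∈ (Finset.univ.filter fun ε : GnoSign L => GoodSign ε),
          ∫ x in BTubeCap L τ 1, gnoDeficit z₀ (fun _ => 1) x.1 ε x.2 * Real.exp (-(b * gnoDeficit z₀ (fun _ => 1) x.1 ε x.2)) ∂chartMeasure L :=
  stub_B_stiff_of_farFloor_pkg stub_B_farFloor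

end Summit.QuantumFields.YangMills.Theorems.SwapVirialDeficit.SectorLaplace

end
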